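import Summits.NavierStokesRegularity.NavierStokesRegularity.Theorems.CircuitPump.Negative.LoadBearing
import Literature.Analysis.Convex.SchauderFixedPoint

/-!
# The clamp trick: covering ⇒ relative periodic point of the truncated lattice
# (crux `PerpetualPump.CircuitPump`, stmt-NavierStokesRegularity-1834;
# line `singular-clock-gspt`, stub C2 `stub_clampCovering`)

Given sound box data (intervals `[lo i, hi i]` at the active scale `n = 0`, compact convex
nonempty sections `Q n` at `n ≠ 0` containing `0` for `|n| > L₀`), a flight-time window
`[T₁ A, T₂ A]` continuous in the amplitude `A = x_{ia,0}`, `ia ≠ ip`, the a priori covering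
structure of the renormalised one-period map at truncation level `L ≥ L₀`, and a continuous flow
`Φ` of the `L`-truncated system on the finite box slice, there are a box datum `x` vanishing off
`|n| ≤ L`, a flight time `T` in its window and the truncated solution `Z` from `x` on `[0, Tmax]`,
weighted-bounded, with `x_{i,n} = lam^{1/5} Z_{i,n+1}(T)` for all `|n| ≤ L`
(`stub_clampCovering`).

Proof (the CLAMP TRICK; no degree theory). Transport the slice to the finite-dimensional space
`V = (Fin m → Icc (-L) L → ℝ) × ℝ`: the image `K₀` of the slice is a product of nonempty compact
convex sets (`clampCovering_box`), and `K = K₀ × [0, 1]`. On `K` consider `F (ξ, θ)`: with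
`x = ext ξ`, `A = x_{ia,0}`, `T = T₁ A + θ (T₂ A - T₁ A)`, `g_{i,n} = lam^{1/5} Φ x T i (n + 1)`,
the sections `n ≠ 0` and the inactive coordinates at `n = 0` go to `g`; the amplitude goes to
`clamp_{[lo ia, hi ia]} (2A - g_{ia,0})`; the phase coordinate is kept; and
`θ ↦ clamp_{[0,1]} (θ + x_{ip,0} - g_{ip,0})`. `F : K → K` is continuous (flow continuity and
continuity of the window), so the tree's Schauder theorem
`Literature.Analysis.Convex.exists_fixedPoint_of_mapsTo_isCompact` gives a fixed point; the
`θ`-equation with the phase signs forces phase matching (`clampCovering_phase`), the amplitude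
equation with the amplitude covering forces `A = g_{ia,0}` (`clampCovering_amp`), and the other
coordinates match by the `F`-equations; the weighted bound is the a priori bound. [folklore]
-/

noncomputable section

-- the summit namespace `…NavierStokesRegularity.NavierStokesRegularity…` is the tree convention
set_option linter.dupNamespace false

namespace Summit.NavierStokesRegularity.NavierStokesRegularity.Theorems.PerpetualPumpCircuitPump

open Set
open Summit.NavierStokesRegularity.NavierStokesRegularity.Theorems.CircuitPumpNegative

/-- **Phase clamp.** If `θ` is fixed by `θ ↦ max 0 (min 1 (θ + d))` and the end-point sign
conditions `θ = 0 → 0 < d`, `θ = 1 → d < 0` hold, then `d = 0`. -/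
theorem clampCovering_phase {θ d : ℝ} (h : max 0 (min 1 (θ + d)) = θ) (h0 : θ = 0 → 0 < d)
    (h1 : θ = 1 → d < 0) : d = 0 := by
  rcases le_total 1 (θ + d) with ha | ha
  · rw [min_eq_left ha, max_eq_right zero_le_one] at h
    linarith [h1 h.symm]
  · rw [min_eq_right ha] at h
    rcases le_total 0 (θ + d) with hb | hb
    · rw [max_eq_right hb] at h; linarith
    · rw [max_eq_left hb] at h; linarith [h0 h.symm]

/-- **Amplitude clamp.** If `A ∈ [lo, hi]` is fixed by `A ↦ max lo (min hi (2A - g))` and the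
covering conditions `A = lo → g < lo`, `A = hi → hi < g` hold, then `A = g`. -/
theorem clampCovering_amp {lo hi A g : ℝ} (hlo : lo ≤ A) (hhi : A ≤ hi)
    (h : max lo (min hi (2 * A - g)) = A) (h1 : A = lo → g < lo) (h2 : A = hi → hi < g) :
    A = g := by
  rcases le_total hi (2 * A - g) with ha | ha
  · rw [min_eq_left ha, max_eq_right (hlo.trans hhi)] at h
    linarith [h2 h.symm]
  · rw [min_eq_right ha] at h
    rcases le_total lo (2 * A - g) with hb | hb
    · rw [max_eq_right hb] at h; linarith
    · rw [max_eq_left hb] at h; linarith [h1 h.symm]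

/-- **The transported box is compact, convex and nonempty.** The set of `ξ : Fin m → J → ℝ` all
of whose slices `fun i => ξ i k` lie in compact convex nonempty sets `B k` is the image of
`Set.pi univ B` under the coordinate swap. -/
theorem clampCovering_box {m : ℕ} {J : Type*} (B : J → Set (Fin m → ℝ))
    (hB : ∀ k, IsCompact (B k) ∧ Convex ℝ (B k) ∧ (B k).Nonempty) :
    IsCompact {ξ : Fin m → J → ℝ | ∀ k, (fun i => ξ i k) ∈ B k} ∧
      Convex ℝ {ξ : Fin m → J → ℝ | ∀ k, (fun i => ξ i k) ∈ B k} ∧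
      {ξ : Fin m → J → ℝ | ∀ k, (fun i => ξ i k) ∈ B k}.Nonempty := by
  have heq : {ξ : Fin m → J → ℝ | ∀ k, (fun i => ξ i k) ∈ B k} =
      (fun (η : J → Fin m → ℝ) (i : Fin m) (k : J) => η k i) '' Set.pi Set.univ B := by
    ext ξ
    refine ⟨fun h => ⟨fun k i => ξ i k, fun k _ => h k, rfl⟩, ?_⟩
    rintro ⟨η, hη, rfl⟩ k
    exact hη k (Set.mem_univ k)
  refine ⟨?_, ?_, ?_⟩
  · rw [heq]
    exact (isCompact_univ_pi fun k => (hB k).1).image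
      (continuous_pi fun i => continuous_pi fun k =>
        (continuous_apply i).comp (continuous_apply k))
  · intro ξ hξ η hη a b ha hb hab k
    exact (hB k).2.1 (hξ k) (hη k) ha hb hab
  · rw [heq]
    exact (Set.univ_pi_nonempty_iff.2 fun k => (hB k).2.2).image _

/-- **Stub C2 (`ClampCovering`).** The clamp trick: sound box data, a flight-time window,
`ia ≠ ip`, the covering structure at level `L ≥ L₀ ≥ 1` and a continuous truncated flow on the
finite box slice give a box state `x` vanishing off `|n| ≤ L`, a flight time `T` in its window and
a weighted-bounded truncated solution `Z` from `x` on `[0, Tmax]` with the relative periodicity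
`x_{i,n} = lam^{1/5} Z_{i,n+1}(T)` for all `|n| ≤ L` (continuous self-map of a compact convex
finite-dimensional set, tree Schauder theorem, clamp analysis). [folklore] -/
theorem stub_clampCovering :
    ∀ (lam : ℝ), 1 < lam → ∀ (m : ℕ) (coeff : Fin m → Fin m → Fin m → Option (Fin 3) → ℝ)
    (lo hi : Fin m → ℝ) (Q : ℤ → Set (Fin m → ℝ)) (ia ip : Fin m) (T₁ T₂ : ℝ → ℝ)
    (C Tmin Tmax : ℝ) (L₀ L : ℕ),
    ia ≠ ip → 1 ≤ L₀ → L₀ ≤ L →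
    ((∀ i : Fin m, lo i ≤ hi i) ∧
      (∀ n : ℤ, n ≠ 0 → IsCompact (Q n) ∧ Convex ℝ (Q n) ∧ (Q n).Nonempty) ∧
      (∀ n : ℤ, (L₀ : ℤ) < |n| → (fun _ : Fin m => (0 : ℝ)) ∈ Q n)) →
    (ContinuousOn T₁ (Set.Icc (lo ia) (hi ia)) ∧ ContinuousOn T₂ (Set.Icc (lo ia) (hi ia)) ∧ 0 < Tmin ∧
      ∀ A ∈ Set.Icc (lo ia) (hi ia), Tmin ≤ T₁ A ∧ T₁ A ≤ T₂ A ∧ T₂ A ≤ Tmax) →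
    (∀ x : Fin m → ℤ → ℝ,
      ((∀ i : Fin m, lo i ≤ x i 0 ∧ x i 0 ≤ hi i) ∧ ∀ n : ℤ, n ≠ 0 → (fun i => x i n) ∈ Q n) →
      (∀ (i : Fin m) (n : ℤ), (L : ℤ) < |n| → x i n = 0) →
      (∀ (T' : ℝ) (Z : Fin m → ℤ → ℝ → ℝ), 0 < T' → T' ≤ Tmax →
          ((∀ (i : Fin m) (n : ℤ), Z i n 0 = x i n) ∧
            (∀ (i : Fin m) (n : ℤ), (L : ℤ) < |n| → ∀ t ∈ Set.Icc (0 : ℝ) T', Z i n t = 0) ∧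
            (∀ (i : Fin m) (n : ℤ), |n| ≤ (L : ℤ) → ∀ t ∈ Set.Icc (0 : ℝ) T',
              HasDerivWithinAt (Z i n)
                (Summit.NavierStokesRegularity.NavierStokesRegularity.Theorems.CircuitPumpNegative.rhsF
                  lam coeff Z i n t) (Set.Icc (0 : ℝ) T') t)) →
          ∀ (i : Fin m) (n : ℤ), ∀ t ∈ Set.Icc (0 : ℝ) T', lam ^ ((3 / 5 : ℝ) * n) * |Z i n t| ≤ C) ∧
      (∀ Z : Fin m → ℤ → ℝ → ℝ,
        ((∀ (i : Fin m) (n : ℤ), Z i n 0 = x i n) ∧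
          (∀ (i : Fin m) (n : ℤ), (L : ℤ) < |n| → ∀ t ∈ Set.Icc (0 : ℝ) Tmax, Z i n t = 0) ∧
          (∀ (i : Fin m) (n : ℤ), |n| ≤ (L : ℤ) → ∀ t ∈ Set.Icc (0 : ℝ) Tmax,
            HasDerivWithinAt (Z i n)
              (Summit.NavierStokesRegularity.NavierStokesRegularity.Theorems.CircuitPumpNegative.rhsF
                lam coeff Z i n t) (Set.Icc (0 : ℝ) Tmax) t)) →
        (∀ T ∈ Set.Icc (T₁ (x ia 0)) (T₂ (x ia 0)),
            (∀ n : ℤ, n ≠ 0 → |n| ≤ (L : ℤ) → (fun i => lam ^ (1 / 5 : ℝ) * Z i (n + 1) T) ∈ Q n) ∧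
            (∀ i : Fin m, i ≠ ia → i ≠ ip →
              lo i ≤ lam ^ (1 / 5 : ℝ) * Z i 1 T ∧ lam ^ (1 / 5 : ℝ) * Z i 1 T ≤ hi i)) ∧
        (∀ T ∈ Set.Icc (T₁ (x ia 0)) (T₂ (x ia 0)), lam ^ (1 / 5 : ℝ) * Z ip 1 T = x ip 0 →
            (x ia 0 = lo ia → lam ^ (1 / 5 : ℝ) * Z ia 1 T < lo ia) ∧
            (x ia 0 = hi ia → hi ia < lam ^ (1 / 5 : ℝ) * Z ia 1 T)) ∧
        (lam ^ (1 / 5 : ℝ) * Z ip 1 (T₁ (x ia 0)) < x ip 0 ∧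
          x ip 0 < lam ^ (1 / 5 : ℝ) * Z ip 1 (T₂ (x ia 0))))) →
    (∃ Φ : (Fin m → ℤ → ℝ) → ℝ → (Fin m → ℤ → ℝ),
      (∀ x : Fin m → ℤ → ℝ,
        ((∀ i : Fin m, lo i ≤ x i 0 ∧ x i 0 ≤ hi i) ∧ ∀ n : ℤ, n ≠ 0 → (fun i => x i n) ∈ Q n) →
        (∀ (i : Fin m) (n : ℤ), (L : ℤ) < |n| → x i n = 0) →
        (∀ (i : Fin m) (n : ℤ), Φ x 0 i n = x i n) ∧
          (∀ (i : Fin m) (n : ℤ), (L : ℤ) < |n| → ∀ t ∈ Set.Icc (0 : ℝ) Tmax, Φ x t i n = 0) ∧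
          (∀ (i : Fin m) (n : ℤ), |n| ≤ (L : ℤ) → ∀ t ∈ Set.Icc (0 : ℝ) Tmax,
            HasDerivWithinAt (fun s => Φ x s i n)
              (Summit.NavierStokesRegularity.NavierStokesRegularity.Theorems.CircuitPumpNegative.rhsF
                lam coeff (fun i' n' s => Φ x s i' n') i n t) (Set.Icc (0 : ℝ) Tmax) t)) ∧
      (∀ (i : Fin m) (n : ℤ), ContinuousOn (fun p : (Fin m → ℤ → ℝ) × ℝ => Φ p.1 p.2 i n)
        ({x : Fin m → ℤ → ℝ |
            ((∀ i : Fin m, lo i ≤ x i 0 ∧ x i 0 ≤ hi i) ∧ ∀ n : ℤ, n ≠ 0 → (fun i => x i n) ∈ Q n) ∧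
            ∀ (i : Fin m) (n : ℤ), (L : ℤ) < |n| → x i n = 0} ×ˢ Set.Icc (0 : ℝ) Tmax))) →
    ∃ (x : Fin m → ℤ → ℝ) (T : ℝ) (Z : Fin m → ℤ → ℝ → ℝ),
      ((∀ i : Fin m, lo i ≤ x i 0 ∧ x i 0 ≤ hi i) ∧ ∀ n : ℤ, n ≠ 0 → (fun i => x i n) ∈ Q n) ∧
      (∀ (i : Fin m) (n : ℤ), (L : ℤ) < |n| → x i n = 0) ∧
      T ∈ Set.Icc (T₁ (x ia 0)) (T₂ (x ia 0)) ∧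
      ((∀ (i : Fin m) (n : ℤ), Z i n 0 = x i n) ∧
        (∀ (i : Fin m) (n : ℤ), (L : ℤ) < |n| → ∀ t ∈ Set.Icc (0 : ℝ) Tmax, Z i n t = 0) ∧
        (∀ (i : Fin m) (n : ℤ), |n| ≤ (L : ℤ) → ∀ t ∈ Set.Icc (0 : ℝ) Tmax,
          HasDerivWithinAt (Z i n)
            (Summit.NavierStokesRegularity.NavierStokesRegularity.Theorems.CircuitPumpNegative.rhsF
              lam coeff Z i n t) (Set.Icc (0 : ℝ) Tmax) t)) ∧
      (∀ (i : Fin m) (n : ℤ), ∀ t ∈ Set.Icc (0 : ℝ) Tmax, lam ^ ((3 / 5 : ℝ) * n) * |Z i n t| ≤ C) ∧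
      ∀ (i : Fin m) (n : ℤ), |n| ≤ (L : ℤ) → x i n = lam ^ (1 / 5 : ℝ) * Z i (n + 1) T := by
  intro lam hlam m coeff lo hi Q ia ip T₁ T₂ C Tmin Tmax L₀ L hip _hL₀ hL hbox hwin hcov hflow
  obtain ⟨Φ, hΦsol, hΦcont⟩ := hflow
  obtain ⟨hlohi, hQ, hQ0⟩ := hbox
  obtain ⟨hT₁c, hT₂c, hTmin, hwin⟩ := hwin
  have hTmax : 0 < Tmax := by
    obtain ⟨h1, h2, h3⟩ := hwin (lo ia) ⟨le_rfl, hlohi ia⟩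
    linarith
  -- the index window `J = Icc (-L) L` and its centre
  have h0abs : |(0 : ℤ)| ≤ (L : ℤ) := by rw [abs_zero]; positivity
  set k0 : ↥(Set.Icc (-(L : ℤ)) (L : ℤ)) := ⟨0, abs_le.1 h0abs⟩ with hk0
  have hkne : ∀ k : ↥(Set.Icc (-(L : ℤ)) (L : ℤ)), k ≠ k0 → (k : ℤ) ≠ 0 :=
    fun k hk h => hk (Subtype.ext h)
  -- transport `ext : (Fin m → J → ℝ) → lattice states` (extension by zero)
  obtain ⟨ext, hext1, hext2⟩ :
      ∃ ext : (Fin m → ↥(Set.Icc (-(L : ℤ)) (L : ℤ)) → ℝ) → Fin m → ℤ → ℝ,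
        (∀ ξ i n (h : |n| ≤ (L : ℤ)), ext ξ i n = ξ i ⟨n, abs_le.1 h⟩) ∧
        (∀ ξ i n, ¬ |n| ≤ (L : ℤ) → ext ξ i n = 0) :=
    ⟨fun ξ i n => if h : |n| ≤ (L : ℤ) then ξ i ⟨n, abs_le.1 h⟩ else 0,
      fun ξ i n h => dif_pos h, fun ξ i n h => dif_neg h⟩
  have hext0 : ∀ ξ i, ext ξ i 0 = ξ i k0 := fun ξ i => hext1 ξ i 0 h0abs
  have hextc : Continuous ext := by
    refine continuous_pi fun i => continuous_pi fun n => ?_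
    by_cases h : |n| ≤ (L : ℤ)
    · exact ((continuous_apply _).comp (continuous_apply i)).congr fun ξ => (hext1 ξ i n h).symm
    · exact continuous_const.congr fun ξ => (hext2 ξ i n h).symm
  -- the sections over the window, and the transported box `K₀`
  obtain ⟨B, hB0, hBk⟩ : ∃ B : ↥(Set.Icc (-(L : ℤ)) (L : ℤ)) → Set (Fin m → ℝ),
      B k0 = Set.pi Set.univ (fun i => Set.Icc (lo i) (hi i)) ∧ ∀ k, k ≠ k0 → B k = Q k :=
    ⟨fun k => if k = k0 then Set.pi Set.univ (fun i => Set.Icc (lo i) (hi i)) else Q k,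
      if_pos rfl, fun k hk => if_neg hk⟩
  have hB : ∀ k, IsCompact (B k) ∧ Convex ℝ (B k) ∧ (B k).Nonempty := by
    intro k
    by_cases hk : k = k0
    · rw [hk, hB0]
      exact ⟨isCompact_univ_pi fun i => isCompact_Icc, convex_pi fun i _ => convex_Icc _ _,
        ⟨fun i => lo i, fun i _ => ⟨le_rfl, hlohi i⟩⟩⟩
    · rw [hBk k hk]
      exact hQ k (hkne k hk)
  obtain ⟨K₀, hK₀m, hK₀c, hK₀conv, hK₀ne⟩ :
      ∃ K₀ : Set (Fin m → ↥(Set.Icc (-(L : ℤ)) (L : ℤ)) → ℝ),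
        (∀ ξ, ξ ∈ K₀ ↔ ∀ k, (fun i => ξ i k) ∈ B k) ∧ IsCompact K₀ ∧ Convex ℝ K₀ ∧ K₀.Nonempty :=
    ⟨_, fun ξ => Iff.rfl, clampCovering_box B hB⟩
  -- `ext` maps `K₀` into the box slice
  have hN : ∀ ξ ∈ K₀, ((∀ i : Fin m, lo i ≤ ext ξ i 0 ∧ ext ξ i 0 ≤ hi i) ∧
      ∀ n : ℤ, n ≠ 0 → (fun i => ext ξ i n) ∈ Q n) ∧
      ∀ (i : Fin m) (n : ℤ), (L : ℤ) < |n| → ext ξ i n = 0 := by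
    intro ξ hξ
    rw [hK₀m] at hξ
    refine ⟨⟨fun i => ?_, fun n hn => ?_⟩, fun i n hn => hext2 ξ i n (not_le.2 hn)⟩
    · rw [hext0]
      have h := hξ k0
      rw [hB0, Set.mem_univ_pi] at h
      exact h i
    · by_cases h : |n| ≤ (L : ℤ)
      · have hk : (⟨n, abs_le.1 h⟩ : ↥(Set.Icc (-(L : ℤ)) (L : ℤ))) ≠ k0 :=
          fun h' => hn (congrArg Subtype.val h')
        have hfun : (fun i => ext ξ i n) = fun i => ξ i ⟨n, abs_le.1 h⟩ :=
          funext fun i => hext1 ξ i n h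
        rw [hfun, ← hBk _ hk]
        exact hξ _
      · have hfun : (fun i => ext ξ i n) = fun _ => (0 : ℝ) := funext fun i => hext2 ξ i n h
        rw [hfun]
        exact hQ0 n (lt_of_le_of_lt (by exact_mod_cast hL) (not_le.1 h))
  -- the flight time as a function on `V = (Fin m → J → ℝ) × ℝ`, and the set `K = K₀ × [0, 1]`
  obtain ⟨Tof, hTof⟩ : ∃ Tof : (Fin m → ↥(Set.Icc (-(L : ℤ)) (L : ℤ)) → ℝ) × ℝ → ℝ,
      ∀ p, Tof p = T₁ (ext p.1 ia 0) + p.2 * (T₂ (ext p.1 ia 0) - T₁ (ext p.1 ia 0)) :=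
    ⟨_, fun p => rfl⟩
  obtain ⟨K, hKm, hKc, hKconv, hKne⟩ :
      ∃ K : Set ((Fin m → ↥(Set.Icc (-(L : ℤ)) (L : ℤ)) → ℝ) × ℝ),
        (∀ p, p ∈ K ↔ p.1 ∈ K₀ ∧ p.2 ∈ Set.Icc (0 : ℝ) 1) ∧ IsCompact K ∧ Convex ℝ K ∧
          K.Nonempty :=
    ⟨K₀ ×ˢ Set.Icc (0 : ℝ) 1, fun p => Iff.rfl, hK₀c.prod isCompact_Icc,
      hK₀conv.prod (convex_Icc 0 1), hK₀ne.prod (nonempty_Icc.2 zero_le_one)⟩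
  have hA : ∀ p ∈ K, ext p.1 ia 0 ∈ Set.Icc (lo ia) (hi ia) :=
    fun p hp => (hN p.1 ((hKm p).1 hp).1).1.1 ia
  have hTwin : ∀ p ∈ K, Tof p ∈ Set.Icc (T₁ (ext p.1 ia 0)) (T₂ (ext p.1 ia 0)) := by
    intro p hp
    obtain ⟨-, h12, -⟩ := hwin _ (hA p hp)
    obtain ⟨h0, h1⟩ := ((hKm p).1 hp).2
    have hd : 0 ≤ T₂ (ext p.1 ia 0) - T₁ (ext p.1 ia 0) := sub_nonneg.2 h12
    rw [hTof p]
    constructor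
    · linarith [mul_nonneg h0 hd]
    · linarith [mul_nonneg (sub_nonneg.2 h1) hd]
  have hT0 : ∀ p ∈ K, Tof p ∈ Set.Icc (0 : ℝ) Tmax := by
    intro p hp
    obtain ⟨h1, -, h3⟩ := hwin _ (hA p hp)
    have h := hTwin p hp
    exact ⟨by linarith [h.1], by linarith [h.2]⟩
  -- continuity on `K` of the coordinates of `ext`, of the flight time, and of the flow along them
  have hpk : ∀ (i : Fin m) (k : ↥(Set.Icc (-(L : ℤ)) (L : ℤ))),
      Continuous fun p : (Fin m → ↥(Set.Icc (-(L : ℤ)) (L : ℤ)) → ℝ) × ℝ => p.1 i k := by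
    intro i k
    fun_prop
  have hec0 : ∀ i, Continuous fun p : (Fin m → ↥(Set.Icc (-(L : ℤ)) (L : ℤ)) → ℝ) × ℝ =>
      ext p.1 i 0 := fun i => (hpk i k0).congr fun p => (hext0 p.1 i).symm
  have hTc : ContinuousOn Tof K := by
    have h1 : ContinuousOn (fun p => T₁ (ext p.1 ia 0)) K :=
      hT₁c.comp (hec0 ia).continuousOn fun p hp => hA p hp
    have h2 : ContinuousOn (fun p => T₂ (ext p.1 ia 0)) K :=
      hT₂c.comp (hec0 ia).continuousOn fun p hp => hA p hp
    exact (h1.add (continuous_snd.continuousOn.mul (h2.sub h1))).congr fun p _ => hTof p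
  have hΦc : ∀ (i : Fin m) (n : ℤ), ContinuousOn (fun p => Φ (ext p.1) (Tof p) i n) K :=
    fun i n => (hΦcont i n).comp ((hextc.comp continuous_fst).continuousOn.prodMk hTc)
      fun p hp => ⟨hN p.1 ((hKm p).1 hp).1, hT0 p hp⟩
  -- the clamp map `F`
  obtain ⟨F, hFk, hFip, hFia, hFi, hFθ⟩ :
      ∃ F : (Fin m → ↥(Set.Icc (-(L : ℤ)) (L : ℤ)) → ℝ) × ℝ →
          (Fin m → ↥(Set.Icc (-(L : ℤ)) (L : ℤ)) → ℝ) × ℝ,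
        (∀ p i k, k ≠ k0 →
          (F p).1 i k = lam ^ (1 / 5 : ℝ) * Φ (ext p.1) (Tof p) i ((k : ℤ) + 1)) ∧
        (∀ p, (F p).1 ip k0 = ext p.1 ip 0) ∧
        (∀ p, (F p).1 ia k0 = max (lo ia) (min (hi ia)
          (2 * ext p.1 ia 0 - lam ^ (1 / 5 : ℝ) * Φ (ext p.1) (Tof p) ia 1))) ∧
        (∀ p i, i ≠ ip → i ≠ ia → (F p).1 i k0 = lam ^ (1 / 5 : ℝ) * Φ (ext p.1) (Tof p) i 1) ∧
        (∀ p, (F p).2 = max 0 (min 1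
          (p.2 + (ext p.1 ip 0 - lam ^ (1 / 5 : ℝ) * Φ (ext p.1) (Tof p) ip 1)))) := by
    refine ⟨fun p => (fun i k => if k = k0 then
        (if i = ip then ext p.1 i 0 else if i = ia then max (lo ia) (min (hi ia)
          (2 * ext p.1 ia 0 - lam ^ (1 / 5 : ℝ) * Φ (ext p.1) (Tof p) ia 1))
          else lam ^ (1 / 5 : ℝ) * Φ (ext p.1) (Tof p) i 1)
        else lam ^ (1 / 5 : ℝ) * Φ (ext p.1) (Tof p) i ((k : ℤ) + 1),
      max 0 (min 1 (p.2 + (ext p.1 ip 0 - lam ^ (1 / 5 : ℝ) * Φ (ext p.1) (Tof p) ip 1)))),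
      fun p i k hk => ?_, fun p => ?_, fun p => ?_, fun p i h1 h2 => ?_, fun p => rfl⟩
    · dsimp only
      rw [if_neg hk]
    · dsimp only
      rw [if_pos rfl, if_pos rfl]
    · dsimp only
      rw [if_pos rfl, if_neg hip, if_pos rfl]
    · dsimp only
      rw [if_pos rfl, if_neg h1, if_neg h2]
  -- `F` maps `K` into `K` (INTO conditions (1) of the covering structure, and the clamps)
  have hmaps : MapsTo F K K := by
    intro p hp
    have hx := hN p.1 ((hKm p).1 hp).1
    obtain ⟨h1, -, -⟩ :=
      (hcov (ext p.1) hx.1 hx.2).2 (fun i n t => Φ (ext p.1) t i n) (hΦsol _ hx.1 hx.2)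
    have hT := hTwin p hp
    refine (hKm (F p)).2 ⟨(hK₀m (F p).1).2 fun k => ?_, ?_⟩
    · by_cases hk : k = k0
      · rw [hk, hB0, Set.mem_univ_pi]
        intro i
        by_cases hi1 : i = ip
        · rw [hi1, hFip]
          exact hx.1.1 ip
        · by_cases hi2 : i = ia
          · rw [hi2, hFia]
            exact ⟨le_max_left _ _, max_le (hlohi ia) (min_le_left _ _)⟩
          · rw [hFi p i hi1 hi2]
            exact (h1 (Tof p) hT).2 i hi2 hi1
      · have hfun : (fun i => (F p).1 i k) =
            fun i => lam ^ (1 / 5 : ℝ) * Φ (ext p.1) (Tof p) i ((k : ℤ) + 1) :=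
          funext fun i => hFk p i k hk
        rw [hfun, hBk k hk]
        exact (h1 (Tof p) hT).1 k (hkne k hk) (abs_le.2 (Set.mem_Icc.1 k.2))
    · rw [hFθ]
      exact ⟨le_max_left _ _, max_le zero_le_one (min_le_left _ _)⟩
  -- `F` is continuous on `K`
  have hFc : ContinuousOn F K := by
    have hθ : ContinuousOn (fun p => (F p).2) K := by
      refine (continuousOn_const.sup (continuousOn_const.inf
        (continuous_snd.continuousOn.add (((hec0 ip).continuousOn).sub
          (continuousOn_const.mul (hΦc ip 1)))))).congr fun p _ => hFθ p
    have h1 : ContinuousOn (fun p => (F p).1) K := by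
      refine continuousOn_pi.2 fun i => continuousOn_pi.2 fun k => ?_
      by_cases hk : k = k0
      · rw [hk]
        by_cases hi1 : i = ip
        · rw [hi1]
          exact (hec0 ip).continuousOn.congr fun p _ => hFip p
        · by_cases hi2 : i = ia
          · rw [hi2]
            exact (continuousOn_const.sup (continuousOn_const.inf
              ((continuousOn_const.mul (hec0 ia).continuousOn).sub
                (continuousOn_const.mul (hΦc ia 1))))).congr fun p _ => hFia p
          · exact (continuousOn_const.mul (hΦc i 1)).congr fun p _ => hFi p i hi1 hi2
      · exact (continuousOn_const.mul (hΦc i ((k : ℤ) + 1))).congr fun p _ => hFk p i k hk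
    exact h1.prodMk hθ
  -- Schauder: a fixed point `p = (ξ, θ)` of `F` in `K`
  obtain ⟨p, hp, hfix⟩ := Literature.Analysis.Convex.exists_fixedPoint_of_mapsTo_isCompact
    hKconv hKc.isClosed hKne hKc hFc hmaps hmaps
  have hpK : p.1 ∈ K₀ := ((hKm p).1 hp).1
  have hx := hN p.1 hpK
  have hT := hTwin p hp
  obtain ⟨h0, h123⟩ := hcov (ext p.1) hx.1 hx.2
  have hZ := hΦsol (ext p.1) hx.1 hx.2
  obtain ⟨-, h2, h3⟩ := h123 (fun i n t => Φ (ext p.1) t i n) hZ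
  have hfix1 : (F p).1 = p.1 := congrArg Prod.fst hfix
  -- phase matching from the `θ`-equation and the phase signs (3)
  have hphase : lam ^ (1 / 5 : ℝ) * Φ (ext p.1) (Tof p) ip 1 = ext p.1 ip 0 := by
    have h : max 0 (min 1 (p.2 + (ext p.1 ip 0 - lam ^ (1 / 5 : ℝ) * Φ (ext p.1) (Tof p) ip 1)))
        = p.2 := by
      rw [← hFθ]
      exact congrArg Prod.snd hfix
    have h31 : lam ^ (1 / 5 : ℝ) * Φ (ext p.1) (T₁ (ext p.1 ia 0)) ip 1 < ext p.1 ip 0 := h3.1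
    have h32 : ext p.1 ip 0 < lam ^ (1 / 5 : ℝ) * Φ (ext p.1) (T₂ (ext p.1 ia 0)) ip 1 := h3.2
    have hθ0 : p.2 = 0 → 0 < ext p.1 ip 0 - lam ^ (1 / 5 : ℝ) * Φ (ext p.1) (Tof p) ip 1 := by
      intro hθ
      have : Tof p = T₁ (ext p.1 ia 0) := by rw [hTof, hθ]; ring
      rw [this]
      linarith
    have hθ1 : p.2 = 1 → ext p.1 ip 0 - lam ^ (1 / 5 : ℝ) * Φ (ext p.1) (Tof p) ip 1 < 0 := by
      intro hθ
      have : Tof p = T₂ (ext p.1 ia 0) := by rw [hTof, hθ]; ring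
      rw [this]
      linarith
    have hd := clampCovering_phase h hθ0 hθ1
    linarith
  -- amplitude matching from the amplitude equation and the amplitude covering (2)
  have hamp : ext p.1 ia 0 = lam ^ (1 / 5 : ℝ) * Φ (ext p.1) (Tof p) ia 1 := by
    have h : (F p).1 ia k0 = p.1 ia k0 := by rw [hfix1]
    rw [hFia, ← hext0 p.1 ia] at h
    have hA' := hA p hp
    have h2' := h2 (Tof p) hT hphase
    exact clampCovering_amp hA'.1 hA'.2 h (fun he => h2'.1 he) (fun he => h2'.2 he)
  -- the relative periodic point
  refine ⟨ext p.1, Tof p, fun i n t => Φ (ext p.1) t i n, hx.1, hx.2, hT, hZ,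
    h0 Tmax _ hTmax le_rfl hZ, fun i n hn => ?_⟩
  show ext p.1 i n = lam ^ (1 / 5 : ℝ) * Φ (ext p.1) (Tof p) i (n + 1)
  by_cases hn0 : n = 0
  · rw [hn0, zero_add, hext0]
    by_cases hi1 : i = ip
    · rw [hi1, ← hext0 p.1 ip]
      exact hphase.symm
    · by_cases hi2 : i = ia
      · rw [hi2, ← hext0 p.1 ia]
        exact hamp
      · have h : (F p).1 i k0 = p.1 i k0 := by rw [hfix1]
        rw [hFi p i hi1 hi2] at h
        exact h.symm
  · have hk : (⟨n, abs_le.1 hn⟩ : ↥(Set.Icc (-(L : ℤ)) (L : ℤ))) ≠ k0 :=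
      fun h' => hn0 (congrArg Subtype.val h')
    have h : (F p).1 i ⟨n, abs_le.1 hn⟩ = p.1 i ⟨n, abs_le.1 hn⟩ := by rw [hfix1]
    rw [hFk p i _ hk] at h
    rw [hext1 p.1 i n hn]
    exact h.symm

end Summit.NavierStokesRegularity.NavierStokesRegularity.Theorems.PerpetualPumpCircuitPump
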